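import Summits.AtomisticToContinuum.Crystallization.Theses.ChessboardParticlePlanes
import Summits.AtomisticToContinuum.Crystallization.Theorems.ChessboardParticlePlanesLjPlaneChessboardYukawaSlicing
import Summits.AtomisticToContinuum.Crystallization.Theorems.ChessboardParticlePlanesLjPlaneChessboardYukawaSliceFourier
import Summits.AtomisticToContinuum.Crystallization.Theorems.ChessboardParticlePlanesLjPlaneChessboardSliceSubstitution
import Mathlib.MeasureTheory.Integral.Prod

/-!
# Crux `ChessboardParticlePlanes.LjPlaneChessboard` (stmt-AtomisticToContinuum-6709), line `Sketch`,
# stub `fourier_ljCrossKernel` — planar Fourier transform of the cross-plane Lennard-Jones kernel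

For a `2`-dimensional real inner-product space `V`, a vertical offset `ζ > 0` and `w ∈ V`, the
real-space cross-plane kernel `K_ζ(v) = V_LJ(√(‖v‖² + ζ²))` between two particle planes at
distance `ζ` is integrable on `V`, and its planar Fourier transform (Mathlib's `𝓕`, kernel
`𝐞(-⟪v, w⟫)`) has the Laplace form
`𝓕[K_ζ](w) = -2π ∫_{λ > q} W(q, λ) e^{-λζ} dλ`, `q = 2π‖w‖`,
`W(q, λ) = (λ²-q²)√(λ²-q²)/144 - (λ²-q²)⁴√(λ²-q²)/43545600`.

Route (tree + Mathlib only):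
* Yukawa slicing `V_LJ(R) = ∫₀^∞ ω(m) e^{-mR}/R dm`, `ω(m) = m¹⁰/43545600 - m⁴/144`,
  `R = √(‖v‖²+ζ²) ≥ ζ > 0` (`stub_yukawaSlicing`);
* Fubini on `V × (0, ∞)` (`MeasureTheory.integral_integral_swap`): the absolute integrand
  `|ω(m)| e^{-mR}/R` has `V`-marginal `|ω(m)| · 2π e^{-mζ}/m` (the Sommerfeld–Weyl transform
  `yukawaFT_fourier_zero` at `w = 0`), and `|ω(m)|/m · e^{-mζ}` is a combination of Euler
  integrands (`integrableOn_pow_mul_exp_neg_mul_Ioi`);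
* slice by slice, `𝓕[e^{-mR}/R](w) = 2π e^{-ζ√(m²+q²)}/√(m²+q²)` (`yukawaFT_fourier_zero`);
* the substitution `λ = √(m²+q²)` (`sliceSubstitution`).

Main results:
* `ljCross_slice_integral` : integrability and
  `∫_V e^{-m√(‖v‖²+u²)}/√(‖v‖²+u²) dv = 2π e^{-um}/m`;
* `ljCross_integrable_prod` : absolute integrability of the sliced kernel on `V × (0, ∞)`;
* `fourier_ljCrossKernel` : the registered stub.
[folklore]
-/

noncomputable section

namespace Summit.AtomisticToContinuum.Crystallization.Theorems.ChessboardParticlePlanesLjPlaneChessboard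

open Literature.MathematicalPhysics.StatisticalMechanics MeasureTheory Set Complex
open scoped Real InnerProductSpace FourierTransform

variable {V : Type*} [NormedAddCommGroup V] [InnerProductSpace ℝ V] [FiniteDimensional ℝ V]
  [MeasurableSpace V] [BorelSpace V]

/-- **The `V`-integral of one Yukawa slice.** For `dim V = 2`, `m, u > 0`, the slice
`v ↦ e^{-m√(‖v‖²+u²)}/√(‖v‖²+u²)` is integrable on `V` and
`∫_V e^{-m√(‖v‖²+u²)}/√(‖v‖²+u²) dv = 2π e^{-um}/m`: this is the Sommerfeld–Weyl transform
`yukawaFT_fourier_zero` at the zero mode `w = 0` (whose non-vanishing forces integrability).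
[folklore] -/
theorem ljCross_slice_integral (hV : Module.finrank ℝ V = 2) {m u : ℝ} (hm : 0 < m)
    (hu : 0 < u) :
    Integrable (fun v : V => ((Real.exp (-(m * Real.sqrt (‖v‖ ^ 2 + u ^ 2))) /
        Real.sqrt (‖v‖ ^ 2 + u ^ 2) : ℝ) : ℂ)) ∧
    ∫ v : V, Real.exp (-(m * Real.sqrt (‖v‖ ^ 2 + u ^ 2))) / Real.sqrt (‖v‖ ^ 2 + u ^ 2) =
      2 * π * Real.exp (-(u * m)) / m := by
  have h := yukawaFT_fourier_zero hV hm hu (0 : V)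
  rw [Real.fourier_eq] at h
  simp only [inner_zero_right, neg_zero, AddChar.map_zero_eq_one, one_smul, norm_zero,
    mul_zero, ne_eq, OfNat.ofNat_ne_zero, not_false_eq_true, zero_pow, add_zero,
    Real.sqrt_sq hm.le] at h
  refine ⟨Integrable.of_integral_ne_zero ?_, ?_⟩
  · rw [h]
    exact Complex.ofReal_ne_zero.2 (by positivity)
  · rw [integral_complex_ofReal] at h
    exact_mod_cast h

/-- **Absolute integrability for Fubini.** For `dim V = 2` and `ζ > 0`, the sliced kernel
`(v, m) ↦ ω(m) e^{-m√(‖v‖²+ζ²)}/√(‖v‖²+ζ²)`, `ω(m) = m¹⁰/43545600 - m⁴/144`, is integrable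
on `V × (0, ∞)`: at fixed `m > 0` it is `ω(m)` times an integrable slice, and its `V`-marginal
`|ω(m)| · 2π e^{-ζm}/m = |2π (m⁹/43545600 - m³/144) e^{-mζ}|` is integrable on `(0, ∞)` by
Euler's integral. [folklore] -/
theorem ljCross_integrable_prod (hV : Module.finrank ℝ V = 2) {ζ : ℝ} (hζ : 0 < ζ) :
    Integrable (Function.uncurry fun (v : V) (m : ℝ) =>
        ((((m ^ 10 / 43545600 - m ^ 4 / 144) *
          (Real.exp (-(m * Real.sqrt (‖v‖ ^ 2 + ζ ^ 2))) /
            Real.sqrt (‖v‖ ^ 2 + ζ ^ 2))) : ℝ) : ℂ))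
      ((volume : Measure V).prod (volume.restrict (Ioi (0 : ℝ)))) := by
  have hmeas : Measurable (Function.uncurry fun (v : V) (m : ℝ) =>
      ((((m ^ 10 / 43545600 - m ^ 4 / 144) *
        (Real.exp (-(m * Real.sqrt (‖v‖ ^ 2 + ζ ^ 2))) /
          Real.sqrt (‖v‖ ^ 2 + ζ ^ 2))) : ℝ) : ℂ)) := by
    unfold Function.uncurry
    fun_prop
  refine (integrable_prod_iff' hmeas.aestronglyMeasurable).2 ⟨?_, ?_⟩
  · refine (ae_restrict_iff' measurableSet_Ioi).2 (Filter.Eventually.of_forall fun m hm => ?_)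
    have hm : (0 : ℝ) < m := hm
    have h1 : (fun v : V => Function.uncurry (fun (v : V) (m : ℝ) =>
        ((((m ^ 10 / 43545600 - m ^ 4 / 144) *
          (Real.exp (-(m * Real.sqrt (‖v‖ ^ 2 + ζ ^ 2))) /
            Real.sqrt (‖v‖ ^ 2 + ζ ^ 2))) : ℝ) : ℂ)) (v, m)) =
        fun v : V => ((m ^ 10 / 43545600 - m ^ 4 / 144 : ℝ) : ℂ) *
          ((Real.exp (-(m * Real.sqrt (‖v‖ ^ 2 + ζ ^ 2))) /
            Real.sqrt (‖v‖ ^ 2 + ζ ^ 2) : ℝ) : ℂ) := by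
      funext v
      simp only [Function.uncurry_apply_pair, Complex.ofReal_mul]
    rw [h1]
    exact (ljCross_slice_integral hV hm hζ).1.const_mul _
  · have hI : IntegrableOn (fun m : ℝ => 2 * π / 43545600 * (m ^ 9 * Real.exp (-(m * ζ))) -
        2 * π / 144 * (m ^ 3 * Real.exp (-(m * ζ)))) (Ioi 0) :=
      ((integrableOn_pow_mul_exp_neg_mul_Ioi 9 hζ).const_mul _).sub
        ((integrableOn_pow_mul_exp_neg_mul_Ioi 3 hζ).const_mul _)
    refine IntegrableOn.congr_fun hI.norm (fun m hm => ?_) measurableSet_Ioi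
    have hm : (0 : ℝ) < m := hm
    simp only [Function.uncurry_apply_pair]
    have h2 : (fun v : V => ‖((((m ^ 10 / 43545600 - m ^ 4 / 144) *
        (Real.exp (-(m * Real.sqrt (‖v‖ ^ 2 + ζ ^ 2))) /
          Real.sqrt (‖v‖ ^ 2 + ζ ^ 2))) : ℝ) : ℂ)‖) =
        fun v : V => ‖(m ^ 10 / 43545600 - m ^ 4 / 144 : ℝ)‖ *
          (Real.exp (-(m * Real.sqrt (‖v‖ ^ 2 + ζ ^ 2))) /
            Real.sqrt (‖v‖ ^ 2 + ζ ^ 2)) := by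
      funext v
      rw [Complex.norm_real, norm_mul, Real.norm_of_nonneg
        (by positivity : (0 : ℝ) ≤ Real.exp (-(m * Real.sqrt (‖v‖ ^ 2 + ζ ^ 2))) /
          Real.sqrt (‖v‖ ^ 2 + ζ ^ 2))]
    rw [h2, integral_const_mul, (ljCross_slice_integral hV hm hζ).2,
      ← Real.norm_of_nonneg (by positivity : (0 : ℝ) ≤ 2 * π * Real.exp (-(ζ * m)) / m),
      ← norm_mul]
    congr 1
    rw [mul_comm ζ m]
    field_simp

/-- **Stub `fourier_ljCrossKernel` — the planar Fourier transform of the cross-plane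
Lennard-Jones kernel in Laplace form.** For a `2`-dimensional real inner-product space `V`,
`ζ > 0` and `w ∈ V`, the kernel `v ↦ V_LJ(√(‖v‖² + ζ²))` is integrable on `V` and
`𝓕[V_LJ(√(‖·‖² + ζ²))](w) = -2π ∫_{λ > 2π‖w‖} W(2π‖w‖, λ) e^{-λζ} dλ` with
`W(q, λ) = (λ²-q²)√(λ²-q²)/144 - (λ²-q²)⁴√(λ²-q²)/43545600`.
Proof: Yukawa slicing (`stub_yukawaSlicing`), Fubini (`ljCross_integrable_prod`,
`MeasureTheory.integral_integral_swap`), the Sommerfeld–Weyl transform of each slice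
(`yukawaFT_fourier_zero`) and the substitution `λ = √(m² + q²)` (`sliceSubstitution`); the
single sign change of `W(q, ·)` reflects reflection positivity of the light Yukawa masses and
anti-positivity of the heavy ones. [folklore] -/
theorem fourier_ljCrossKernel :
    ∀ (V : Type) [NormedAddCommGroup V] [InnerProductSpace ℝ V] [FiniteDimensional ℝ V]
      [MeasurableSpace V] [BorelSpace V],
      Module.finrank ℝ V = 2 →
      ∀ (ζ : ℝ) (w : V), 0 < ζ →
        MeasureTheory.Integrable (fun v : V =>
          ((lennardJones (Real.sqrt (‖v‖ ^ 2 + ζ ^ 2)) : ℝ) : ℂ)) ∧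
        𝓕 (fun v : V => ((lennardJones (Real.sqrt (‖v‖ ^ 2 + ζ ^ 2)) : ℝ) : ℂ)) w =
          ((-(2 * π) *
              ∫ l in Set.Ioi (2 * π * ‖w‖),
                ((l ^ 2 - (2 * π * ‖w‖) ^ 2) * Real.sqrt (l ^ 2 - (2 * π * ‖w‖) ^ 2) / 144
                  - (l ^ 2 - (2 * π * ‖w‖) ^ 2) ^ 4 * Real.sqrt (l ^ 2 - (2 * π * ‖w‖) ^ 2)
                      / 43545600) * Real.exp (-(l * ζ)) : ℝ) : ℂ) := by
  intro V _ _ _ _ _ hV ζ w hζ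
  -- Step 1: Yukawa slicing of the kernel.
  have hfun : (fun v : V => ((lennardJones (Real.sqrt (‖v‖ ^ 2 + ζ ^ 2)) : ℝ) : ℂ)) =
      fun v : V => ∫ m in Ioi (0 : ℝ), ((((m ^ 10 / 43545600 - m ^ 4 / 144) *
        (Real.exp (-(m * Real.sqrt (‖v‖ ^ 2 + ζ ^ 2))) /
          Real.sqrt (‖v‖ ^ 2 + ζ ^ 2))) : ℝ) : ℂ) := by
    funext v
    rw [stub_yukawaSlicing _ (Real.sqrt_pos.2 (by positivity)), integral_complex_ofReal]
  have hint := ljCross_integrable_prod hV hζ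
  refine ⟨?_, ?_⟩
  · rw [hfun]
    simpa only [Function.uncurry_apply_pair] using hint.integral_prod_left
  rw [hfun, Real.fourier_eq]
  -- Step 2: Fubini.
  have hintC : Integrable (Function.uncurry fun (v : V) (m : ℝ) => 𝐞 (-⟪v, w⟫_ℝ) •
      ((((m ^ 10 / 43545600 - m ^ 4 / 144) *
        (Real.exp (-(m * Real.sqrt (‖v‖ ^ 2 + ζ ^ 2))) /
          Real.sqrt (‖v‖ ^ 2 + ζ ^ 2))) : ℝ) : ℂ))
      ((volume : Measure V).prod (volume.restrict (Ioi (0 : ℝ)))) := by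
    refine hint.mono ?_ ?_
    · exact (Real.continuous_fourierChar.comp (by fun_prop)).aestronglyMeasurable.smul
        hint.aestronglyMeasurable
    · filter_upwards with ⟨v, t⟩
      simp only [Function.uncurry_apply_pair, Circle.norm_smul]
      exact le_rfl
  have hswap : (∫ v : V, 𝐞 (-⟪v, w⟫_ℝ) • ∫ m in Ioi (0 : ℝ),
      ((((m ^ 10 / 43545600 - m ^ 4 / 144) *
        (Real.exp (-(m * Real.sqrt (‖v‖ ^ 2 + ζ ^ 2))) /
          Real.sqrt (‖v‖ ^ 2 + ζ ^ 2))) : ℝ) : ℂ)) =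
      ∫ m in Ioi (0 : ℝ), ∫ v : V, 𝐞 (-⟪v, w⟫_ℝ) •
        ((((m ^ 10 / 43545600 - m ^ 4 / 144) *
          (Real.exp (-(m * Real.sqrt (‖v‖ ^ 2 + ζ ^ 2))) /
            Real.sqrt (‖v‖ ^ 2 + ζ ^ 2))) : ℝ) : ℂ) := by
    refine Eq.trans ?_ (integral_integral_swap hintC)
    congr 1 with v
    simp_rw [Circle.smul_def, integral_smul]
  rw [hswap]
  -- Step 3: the Sommerfeld–Weyl transform of each slice.
  have hinner : ∀ m ∈ Ioi (0 : ℝ), (∫ v : V, 𝐞 (-⟪v, w⟫_ℝ) •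
      ((((m ^ 10 / 43545600 - m ^ 4 / 144) *
        (Real.exp (-(m * Real.sqrt (‖v‖ ^ 2 + ζ ^ 2))) /
          Real.sqrt (‖v‖ ^ 2 + ζ ^ 2))) : ℝ) : ℂ)) =
      ((((m ^ 10 / 43545600 - m ^ 4 / 144) *
        (2 * π * Real.exp (-(ζ * Real.sqrt (m ^ 2 + (2 * π * ‖w‖) ^ 2))) /
          Real.sqrt (m ^ 2 + (2 * π * ‖w‖) ^ 2))) : ℝ) : ℂ) := by
    intro m hm
    have hm : (0 : ℝ) < m := hm
    have hF := yukawaFT_fourier_zero hV hm hζ w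
    rw [Real.fourier_eq] at hF
    rw [Complex.ofReal_mul, ← hF, ← integral_const_mul]
    congr 1 with v
    rw [Circle.smul_def, Circle.smul_def, smul_eq_mul, smul_eq_mul, Complex.ofReal_mul]
    ring
  rw [setIntegral_congr_fun measurableSet_Ioi hinner, integral_complex_ofReal]
  congr 1
  -- Step 4: the substitution `λ = √(m² + q²)`.
  obtain ⟨-, hsub⟩ := sliceSubstitution (2 * π * ‖w‖) ζ (by positivity) hζ
  have h3 : (fun m : ℝ => (m ^ 10 / 43545600 - m ^ 4 / 144) *
      (2 * π * Real.exp (-(ζ * Real.sqrt (m ^ 2 + (2 * π * ‖w‖) ^ 2))) /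
        Real.sqrt (m ^ 2 + (2 * π * ‖w‖) ^ 2))) =
      fun m : ℝ => 2 * π * ((m ^ 10 / 43545600 - m ^ 4 / 144) *
        (Real.exp (-(ζ * Real.sqrt (m ^ 2 + (2 * π * ‖w‖) ^ 2))) /
          Real.sqrt (m ^ 2 + (2 * π * ‖w‖) ^ 2))) := by
    funext m
    ring
  rw [h3, integral_const_mul, hsub]
  ring

end Summit.AtomisticToContinuum.Crystallization.Theorems.ChessboardParticlePlanesLjPlaneChessboard

end
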